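import Summits.Langlands.Langlands.Theorems.PhaseMomentSplitHeart

/-!
# `DeterminantLockSplit` — HEART: §0 (the locked dial) + §1 (the decided heart)

(decomp-langlands cell, lens-4 g35, RESIDUAL MODE.  This file carries the pure finite-group / real-algebra half of the node and imports ONLY
the tree module `Theorems.PhaseMomentSplitHeart` (lens-4 g34, census twin): `PhaseSupport`, `stMoment`, `quartic`, `PhaseMomentCertificate`,
the root-of-unity identities `support_one … support_five`, and the two certificate quartics `certPoly = (x+1)(x−2)(x²−3x+1)`,
`certB = x⁴−5x³+5x²+5x−5` with their Sato–Tate pairings `−1`, `−2`.  The companion module `Theorems.DeterminantLockSplit` = the node's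
module docstring + §2–§4 (pieces, kernel, host edges), importing this one.)

THE LOCK IN ONE LINE.  Through a PERFECT layer `L/K` the determinant of the candidate is not free: `det ρ₀` and the `ℓ`-adic avatar `Ω` of the
central character of `π` both restrict to `det r` on `Γ_L`, two descents of one character through a perfect quotient COINCIDE
(`descent_unique_of_perfect`), so `det ρ₀ = Ω` and at a place `v` inert in `M` the Satake pair satisfies `t₁t₂ = det ρ₀(Frob_v) = −γ_v²` ON THE
NOSE — the phase `−t₁/t₂` is then the SQUARE of an `f`-th root of unity (`locked_phase_of_powers`) and the adjoint trace lives on the LOCKED support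
`V_{f/(2,f)}` (`LockedPhaseSupport`; `lockedSupport_halve`): half the phases of even order are gone, and the degree-4 moment LP of g34 certifies
`A₇`, `SL₂(𝔽₇)`, `SL₂(𝔽₉)`, `A₅ × A₅`, `M₁₁`, `SL₃(𝔽₃)`, `A₈`, `PSL₂(𝔽₁₇)`, `SL₂(𝔽₁₁)` — the first six by the two UNIVERSAL kernel certificates
below (`lockedCert_of_fewHighOrders`, `lockedCert_of_lowOrderMass`), which depend on `G` through TWO element counts only.
-/

set_option linter.dupNamespace false
set_option linter.style.longLine false

noncomputable section

namespace Summit.Langlands.Langlands.Theorems.DeterminantLockSplit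

open scoped BigOperators Topology Matrix Classical NumberField Polynomial
open Filter Set Function
open Summit.Langlands.Langlands.Theorems.PhaseMomentSplit (PhaseSupport stMoment quartic PhaseMomentCertificate certPoly certB
  quartic_certPoly quartic_certB stPairing_certPoly stPairing_certB certPoly_nonneg certB_ge_one
  support_one support_two support_three support_four support_five)

/-! ## §0 The dial under the determinant lock (pure finite-group / real-algebra data) -/

/-- [new] **Locked phase support of order `f`.**  Under the DETERMINANT LOCK `t₁t₂ = −γ²` at a place inert in `M` whose Frobenius has order `f`
in the layer group, the phase `−t₁/t₂` is the SQUARE `w²` of an `f`-th root of unity `w` (kernel `locked_phase_of_powers`), so the adjoint trace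
`X = t₁/t₂ + 1 + t₂/t₁ = 1 − w² − w⁻²` ranges over `{1 − 2cos(4πk/f)} = V_{f/gcd(2,f)}`: `V_1 = {−1}` for `f = 1, 2`; `V_2 = {−1, 3}` for `f = 4`;
`V_3 = {−1, 2}` for `f = 3, 6`; `V_4 = {−1, 1, 3}` for `f = 8`; `V_5` for `f = 5, 10` (`lockedSupport_phase`, `lockedSupport_halve`). -/
def LockedPhaseSupport (f : ℕ) (x : ℝ) : Prop := ∃ w : ℂ, w ^ f = 1 ∧ (x : ℂ) = 1 - w ^ 2 - (w ^ 2)⁻¹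

/-- [new] **`LockedPhaseMomentCertificate G`** — g34's phase-moment certificate with the phase supports replaced by the LOCKED supports:
a real quartic `P = Σ p_j x^j` and per-order constants `κ_f` with `κ_{ord g} ≤ P` on the locked support of order `ord g` for every `g ∈ G`, and
`(Σ_j p_j m_j) · |G| < Σ_{g ∈ G} κ_{ord g}` (`m = (1,0,1,1,3)` the `SO(3)` Sato–Tate moments).  WEAKER demand than g34's (`lockedCert_of_cert`:
the supports shrank); `0 < Nat.card G` keeps it FALSE on infinite `G`.  Decided TRUE by the kernel for every finite group in which fewer than `5/18`
of the elements have order outside `{1,2,3,4,5,6,8,10}` (`lockedCert_of_fewHighOrders`) or in which `400|G| < 700·#{ord ∈ {1,2,3,4,6,8}} +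
338·#{ord ∈ {5,10}}` (`lockedCert_of_lowOrderMass`); an LP in `5 + #ord(G)` unknowns in general (instrument I-g35.1). -/
def LockedPhaseMomentCertificate (G : Type*) [Group G] : Prop :=
  ∃ (p : Fin 5 → ℝ) (κ : ℕ → ℝ), 0 < Nat.card G ∧ (∀ g : G, ∀ x : ℝ, LockedPhaseSupport (orderOf g) x → κ (orderOf g) ≤ quartic p x) ∧
    (∑ j : Fin 5, p j * stMoment j) * (Nat.card G : ℝ) < ∑ᶠ g : G, κ (orderOf g)

/-- The orders whose LOCKED support lies inside `V_1 ∪ V_2 ∪ V_3 ∪ V_4 ∪ V_5`, where g34's icosahedral quartic `certPoly` is `≥ 0`. -/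
def goodOrders : Finset ℕ := {1, 2, 3, 4, 5, 6, 8, 10}

/-- The orders whose locked support lies inside `{−1, 1, 2, 3}`, where `certB = 1`. -/
def lowOrders : Finset ℕ := {1, 2, 3, 4, 6, 8}

/-- The orders whose locked support is `V_5 = {−1, (3 ∓ √5)/2}`, where `certB ≥ −(3+√5)/2 > −131/50`. -/
def fiveOrders : Finset ℕ := {5, 10}

/-! ## §1 The decided heart (kernel-certified) -/

section Heart

/-! ### The lock (group form) and the locked phase (Galois side of Step 1) -/

/-- A homomorphism from a PERFECT group to an abelian group is trivial. [folklore] -/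
theorem hom_eq_one_of_commutator_eq_top {G A : Type*} [Group G] [CommGroup A] (h : commutator G = ⊤) (φ : G →* A) : φ = 1 := by
  ext g
  have hg : g ∈ φ.ker := Abelianization.commutator_subset_ker φ (by rw [h]; exact Subgroup.mem_top g)
  rw [MonoidHom.mem_ker] at hg
  rw [hg, MonoidHom.one_apply]

/-- **THE DETERMINANT LOCK (descents through a perfect layer are unique).**  Two characters `χ₁, χ₂ : Γ → A` (`A` abelian) that agree on a normal
subgroup `N` with PERFECT quotient `Γ ⧸ N` are EQUAL: `χ₁χ₂⁻¹` factors through `Γ ⧸ N`, a perfect group, and dies.  Applied to `Γ = Γ_K`,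
`N = Γ_L`, `Γ ⧸ N = Gal(L/K)` perfect, `χ₁ = det ρ₀`, `χ₂ = Ω` (the `ℓ`-adic avatar of the central character of `π`; tree W1
`TatePhantomLift.LayerDeterminantDescent`, Weil 1956 in print), both restricting to `det r`: `det ρ₀ = Ω`, i.e. `det ρ₀(Frob_v) = t₁t₂` at almost
every place `v` of `K` — the inert ones included, where the relation through `L` alone sees only `(t₁t₂)^f`. [folklore] -/
theorem descent_unique_of_perfect {Γ A : Type*} [Group Γ] [CommGroup A] (N : Subgroup Γ) [N.Normal]
    (hperf : commutator (Γ ⧸ N) = ⊤) (χ₁ χ₂ : Γ →* A) (h : ∀ n ∈ N, χ₁ n = χ₂ n) : χ₁ = χ₂ := by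
  set f : Γ →* A := χ₁ * χ₂⁻¹ with hf
  have hN : N ≤ f.ker := by
    intro n hn
    rw [MonoidHom.mem_ker, hf, MonoidHom.mul_apply, MonoidHom.inv_apply, h n hn, mul_inv_cancel]
  have hlift := hom_eq_one_of_commutator_eq_top hperf (QuotientGroup.lift N f hN)
  ext g
  have hfg : f g = 1 := by rw [← QuotientGroup.lift_mk N hN g, hlift, MonoidHom.one_apply]
  rw [hf, MonoidHom.mul_apply, MonoidHom.inv_apply, mul_inv_eq_one] at hfg
  exact hfg

/-- **Where the locked phase comes from** (Galois side of Step 1, sharpening g34's `phase_of_powers`).  At a place `v` inert in `M` the candidate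
`ρ₀ ≅ Ind χ₀` has eigenvalues `{γ, −γ}`, hence DETERMINANT `−γ²`; the lock `det ρ₀ = Ω` makes the Satake pair satisfy `t₁t₂ = −γ²` EXACTLY, while
the relation through a place `w | v` of residue degree `f` says `t₁^f ∈ {γ^f, (−γ)^f}`.  Then `w := ±t₁/γ` is an `f`-th root of unity and
`t₁/t₂ = −t₁²/γ² = −w²`: the adjoint trace is `1 − w² − w⁻²`, a point of the LOCKED support `V_{f/gcd(2,f)}` (for even `f` only the squares of
`μ_f` occur — half of g34's phases are forbidden). -/
theorem locked_phase_of_powers {t₁ t₂ γ : ℂ} {f : ℕ} (hγ : γ ≠ 0) (hdet : t₁ * t₂ = -γ ^ 2)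
    (h : t₁ ^ f = γ ^ f ∨ t₁ ^ f = (-γ) ^ f) :
    ∃ w : ℂ, w ^ f = 1 ∧ t₁ / t₂ + 1 + t₂ / t₁ = 1 - w ^ 2 - (w ^ 2)⁻¹ := by
  have ht₁ : t₁ ≠ 0 := by
    rintro rfl
    rw [zero_mul, eq_comm, neg_eq_zero] at hdet
    exact hγ (pow_eq_zero_iff two_ne_zero |>.mp hdet)
  have ht₂ : t₂ ≠ 0 := by
    rintro rfl
    rw [mul_zero, eq_comm, neg_eq_zero] at hdet
    exact hγ (pow_eq_zero_iff two_ne_zero |>.mp hdet)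
  have ht₂' : t₂ = -γ ^ 2 / t₁ := by
    field_simp
    linear_combination hdet
  have key : t₁ / t₂ + 1 + t₂ / t₁ = 1 - (t₁ / γ) ^ 2 - ((t₁ / γ) ^ 2)⁻¹ := by
    rw [ht₂']
    field_simp
    ring
  rcases h with h | h
  · exact ⟨t₁ / γ, by rw [div_pow, h, div_self (pow_ne_zero _ hγ)], key⟩
  · refine ⟨t₁ / (-γ), by rw [div_pow, h, div_self (pow_ne_zero _ (neg_ne_zero.mpr hγ))], ?_⟩
    rw [key, div_neg, neg_sq]

/-! ### Locked supports are phase supports of HALF the order -/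

/-- The locked support of order `f` lies in g34's phase support of order `f` (`ζ = w²`, `ζ^f = (w^f)² = 1`). -/
theorem lockedSupport_phase {f : ℕ} {x : ℝ} (h : LockedPhaseSupport f x) : PhaseSupport f x := by
  obtain ⟨w, hw, hx⟩ := h
  exact ⟨w ^ 2, by rw [← pow_mul, mul_comm, pow_mul, hw, one_pow], hx⟩

/-- **Halving.**  The locked support of EVEN order `f = 2m` lies in the phase support of order `m` (`ζ = w²`, `ζ^m = w^{2m} = 1`). -/
theorem lockedSupport_halve {f m : ℕ} (hf : f = 2 * m) {x : ℝ} (h : LockedPhaseSupport f x) : PhaseSupport m x := by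
  obtain ⟨w, hw, hx⟩ := h
  subst hf
  exact ⟨w ^ 2, by rw [← pow_mul]; exact hw, hx⟩

/-- Every phase-moment certificate is a locked one (the termwise demand is made on a smaller support): the g34-certified layer groups stay certified. -/
theorem lockedCert_of_cert {G : Type*} [Group G] (h : PhaseMomentCertificate G) : LockedPhaseMomentCertificate G := by
  obtain ⟨p, κ, h0, h1, h2⟩ := h
  exact ⟨p, κ, h0, fun g x hx => h1 g x (lockedSupport_phase hx), h2⟩

/-- The locked supports of the orders `1, 2, 3, 4, 6, 8` lie in `{−1, 1, 2, 3}`. -/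
theorem lockedSupport_low {f : ℕ} (hf : f ∈ lowOrders) {x : ℝ} (h : LockedPhaseSupport f x) : x = -1 ∨ x = 1 ∨ x = 2 ∨ x = 3 := by
  simp only [lowOrders, Finset.mem_insert, Finset.mem_singleton] at hf
  rcases hf with rfl | rfl | rfl | rfl | rfl | rfl
  · exact Or.inl (support_one (lockedSupport_phase h))
  · exact Or.inl (support_one (lockedSupport_halve (m := 1) rfl h))
  · rcases mul_eq_zero.mp (support_three (lockedSupport_phase h)) with h | h
    · exact Or.inl (by linarith)
    · exact Or.inr (Or.inr (Or.inl (by linarith)))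
  · rcases mul_eq_zero.mp (support_two (lockedSupport_halve (m := 2) rfl h)) with h | h
    · exact Or.inl (by linarith)
    · exact Or.inr (Or.inr (Or.inr (by linarith)))
  · rcases mul_eq_zero.mp (support_three (lockedSupport_halve (m := 3) rfl h)) with h | h
    · exact Or.inl (by linarith)
    · exact Or.inr (Or.inr (Or.inl (by linarith)))
  · rcases mul_eq_zero.mp (support_four (lockedSupport_halve (m := 4) rfl h)) with h | h
    · rcases mul_eq_zero.mp h with h | h
      · exact Or.inl (by linarith)
      · exact Or.inr (Or.inl (by linarith))
    · exact Or.inr (Or.inr (Or.inr (by linarith)))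

/-- The locked supports of the orders `5, 10` lie in `V_5 = {−1} ∪ {x² − 3x + 1 = 0}`. -/
theorem lockedSupport_five {f : ℕ} (hf : f ∈ fiveOrders) {x : ℝ} (h : LockedPhaseSupport f x) : x = -1 ∨ x ^ 2 - 3 * x + 1 = 0 := by
  simp only [fiveOrders, Finset.mem_insert, Finset.mem_singleton] at hf
  rcases hf with rfl | rfl
  · rcases mul_eq_zero.mp (support_five (lockedSupport_phase h)) with h | h
    · exact Or.inl (by linarith)
    · exact Or.inr h
  · rcases mul_eq_zero.mp (support_five (lockedSupport_halve (m := 5) rfl h)) with h | h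
    · exact Or.inl (by linarith)
    · exact Or.inr h

/-- The locked supports of the orders in `goodOrders = {1,2,3,4,5,6,8,10}` lie in `V_1 ∪ … ∪ V_5`, where `certPoly ≥ 0` (tree `certPoly_nonneg`). -/
theorem certPoly_nonneg_locked {f : ℕ} (hf : f ∈ goodOrders) {x : ℝ} (h : LockedPhaseSupport f x) : 0 ≤ quartic certPoly x := by
  simp only [goodOrders, Finset.mem_insert, Finset.mem_singleton] at hf
  rcases hf with rfl | rfl | rfl | rfl | rfl | rfl | rfl | rfl
  · exact certPoly_nonneg (f := 1) le_rfl (by norm_num) (lockedSupport_phase h)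
  · exact certPoly_nonneg (f := 1) le_rfl (by norm_num) (lockedSupport_halve (m := 1) rfl h)
  · exact certPoly_nonneg (f := 3) (by norm_num) (by norm_num) (lockedSupport_phase h)
  · exact certPoly_nonneg (f := 2) (by norm_num) (by norm_num) (lockedSupport_halve (m := 2) rfl h)
  · exact certPoly_nonneg (f := 5) (by norm_num) le_rfl (lockedSupport_phase h)
  · exact certPoly_nonneg (f := 3) (by norm_num) (by norm_num) (lockedSupport_halve (m := 3) rfl h)
  · exact certPoly_nonneg (f := 4) (by norm_num) (by norm_num) (lockedSupport_halve (m := 4) rfl h)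
  · exact certPoly_nonneg (f := 5) (by norm_num) le_rfl (lockedSupport_halve (m := 5) rfl h)

/-! ### Global lower bounds of the two certificate quartics (sum-of-squares identities) -/

/-- `certPoly + 18/5 = x⁴ − 4x³ + 2x² + 5x + 8/5 = (8/5)(1 + 25x/16 − 3x²/4)² + (79/160)(x − 20x²/79)² + (27/395)x⁴ ≥ 0` on all of `ℝ`
(true minimum `≈ −3.444` at `x ≈ −0.47`). -/
theorem certPoly_ge (x : ℝ) : -(18 / 5 : ℝ) ≤ quartic certPoly x := by
  have e : quartic certPoly x + 18 / 5 =
      8 / 5 * (1 + 25 / 16 * x - 3 / 4 * x ^ 2) ^ 2 + 79 / 160 * (x - 20 / 79 * x ^ 2) ^ 2 + 27 / 395 * x ^ 4 := by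
    rw [quartic_certPoly]; ring
  have h4 : (0 : ℝ) ≤ x ^ 4 := by positivity
  nlinarith [sq_nonneg (1 + 25 / 16 * x - 3 / 4 * x ^ 2), sq_nonneg (x - 20 / 79 * x ^ 2), h4]

/-- `certB + 6 = x⁴ − 5x³ + 5x² + 5x + 1 = (1 + 5x/2 − 15x²/16)² + (5/8)(x − x²/4)² + (21/256)x⁴ ≥ 0` on all of `ℝ` (true minimum `≈ −5.916`). -/
theorem certB_ge (x : ℝ) : -(6 : ℝ) ≤ quartic certB x := by
  have e : quartic certB x + 6 = (1 + 5 / 2 * x - 15 / 16 * x ^ 2) ^ 2 + 5 / 8 * (x - 1 / 4 * x ^ 2) ^ 2 + 21 / 256 * x ^ 4 := by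
    rw [quartic_certB]; ring
  have h4 : (0 : ℝ) ≤ x ^ 4 := by positivity
  nlinarith [sq_nonneg (1 + 5 / 2 * x - 15 / 16 * x ^ 2), sq_nonneg (x - 1 / 4 * x ^ 2), h4]

/-- On `V_5`:  `certB = x − 3 ≥ −131/50` at the roots of `x² − 3x + 1` (they lie in `(19/50, 131/50)`), and `certB(−1) = 1`. -/
theorem certB_locked_five {x : ℝ} (hx : x = -1 ∨ x ^ 2 - 3 * x + 1 = 0) : -(131 / 50 : ℝ) ≤ quartic certB x := by
  rcases hx with rfl | h
  · rw [quartic_certB]; norm_num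
  · have hP : quartic certB x = x - 3 := by rw [quartic_certB]; linear_combination (x ^ 2 - 2 * x - 2) * h
    rw [hP]
    nlinarith [sq_nonneg (x - 19 / 50)]

/-! ### Counting elements by order class -/

/-- the number of elements whose order satisfies `q`, as a sum of indicators -/
theorem card_orderPred_eq_sum (G : Type*) [Group G] [Fintype G] (q : ℕ → Prop) [DecidablePred q] :
    (Nat.card {g : G // q (orderOf g)} : ℝ) = ∑ g : G, (if q (orderOf g) then (1 : ℝ) else 0) := by
  rw [Finset.sum_boole, Nat.card_eq_fintype_card, Fintype.card_subtype]

/-! ### The two universal locked certificates -/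

/-- **CERT-II · the LOCKED ICOSAHEDRAL CLASS is moment-rigid.**  Every finite group in which FEWER THAN `5/18` of the elements have order outside
`{1, 2, 3, 4, 5, 6, 8, 10}` carries a locked phase-moment certificate: `P = certPoly = (x+1)(x−2)(x²−3x+1)` (`∫P dμ_ST = −1`), `κ = 0` on the good
orders (their LOCKED supports lie in `V_1 ∪ … ∪ V_5`, where `P ≥ 0` — for the orders `6, 8, 10` this is the lock at work: g34's supports `V_6 ∋ 0`,
`V_8`, `V_10` carry negative values of `P`), `κ = −18/5` elsewhere (global bound).  Instances: every `G` of spectrum `⊆ {1,2,3,4,5,6,8,10}`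
(`SL₂(𝔽₅)`, `SL₂(𝔽₉)`, … : `lockedCert_of_goodSpectrum`), `A₅ × A₅` (`960` elements of order `15` out of `3600`: `18·960 < 5·3600`), `M₁₁`
(`1440` of order `11` out of `7920`). -/
theorem lockedCert_of_fewHighOrders (G : Type*) [Group G] [Finite G]
    (h : 18 * Nat.card {g : G // orderOf g ∉ goodOrders} < 5 * Nat.card G) : LockedPhaseMomentCertificate G := by
  haveI := Fintype.ofFinite G
  refine ⟨certPoly, fun f => if f ∈ goodOrders then 0 else -(18 / 5), Nat.card_pos, ?_, ?_⟩
  · intro g x hx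
    dsimp only
    by_cases hg : orderOf g ∈ goodOrders
    · rw [if_pos hg]; exact certPoly_nonneg_locked hg hx
    · rw [if_neg hg]; exact certPoly_ge x
  · have hdec : ∀ g : G, (if orderOf g ∈ goodOrders then (0 : ℝ) else -(18 / 5)) =
        -(18 / 5) * (if orderOf g ∉ goodOrders then (1 : ℝ) else 0) := by
      intro g; by_cases hg : orderOf g ∈ goodOrders <;> simp [hg]
    rw [stPairing_certPoly, finsum_eq_sum_of_fintype, Finset.sum_congr rfl (fun g _ => hdec g), ← Finset.mul_sum,
      ← card_orderPred_eq_sum G (fun n => n ∉ goodOrders)]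
    have hc : (18 : ℝ) * (Nat.card {g : G // orderOf g ∉ goodOrders} : ℝ) < 5 * (Nat.card G : ℝ) := by exact_mod_cast h
    linarith

/-- **Every finite group of order spectrum `⊆ {1,2,3,4,5,6,8,10}` is lock-certified** (`SL₂(𝔽₅)`: g34 needed the class masses and `√5 < 5/2`;
`SL₂(𝔽₉)`: SILENT for g34 at degree 4; any perfect group with these element orders, over any base field, Maass `π` allowed). -/
theorem lockedCert_of_goodSpectrum (G : Type*) [Group G] [Finite G] (h : ∀ g : G, orderOf g ∈ goodOrders) :
    LockedPhaseMomentCertificate G := by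
  apply lockedCert_of_fewHighOrders
  have h0 : Nat.card {g : G // orderOf g ∉ goodOrders} = 0 := by
    rw [Nat.card_eq_zero]; exact Or.inl ⟨fun ⟨g, hg⟩ => hg (h g)⟩
  rw [h0, mul_zero]
  exact Nat.mul_pos (by norm_num) Nat.card_pos

/-- **CERT-I · low-order mass.**  Every finite group with `400·|G| < 700·#{g : ord g ∈ {1,2,3,4,6,8}} + 338·#{g : ord g ∈ {5,10}}` carries a locked
phase-moment certificate: `P = certB = x⁴−5x³+5x²+5x−5` (`∫P dμ_ST = −2`), `κ = 1` on `{1,2,3,4,6,8}` (locked supports `⊆ {−1,1,2,3}`, where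
`P = 1`), `κ = −131/50` on `{5,10}` (`P ≥ −(3+√5)/2` on `V_5`), `κ = −6` elsewhere (global bound); the inequality is `−2 < −6 + 7a + (169/50)b`.
Instances (GAP order statistics): `A₇` (`|G| = 2520`, `a·|G| = 1296`, `b·|G| = 504`), `SL₂(𝔽₇)` (`336; 240, 0`), `PSL₂(𝔽₇)` (`168; 120, 0`),
`PSL₂(𝔽₁₁)` (`660; 276, 264`), `SL₂(𝔽₉)` (`720; 432, 288`), `M₁₁` (`7920; 4896, 1584`), `SL₃(𝔽₃)` (`5616; 3888, 0`) — all SILENT for g34 except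
`PSL₂(𝔽₇)`, `PSL₂(𝔽₁₁)` (there float-LP only). -/
theorem lockedCert_of_lowOrderMass (G : Type*) [Group G] [Finite G]
    (h : 400 * Nat.card G < 700 * Nat.card {g : G // orderOf g ∈ lowOrders} + 338 * Nat.card {g : G // orderOf g ∈ fiveOrders}) :
    LockedPhaseMomentCertificate G := by
  haveI := Fintype.ofFinite G
  refine ⟨certB, fun f => if f ∈ lowOrders then 1 else if f ∈ fiveOrders then -(131 / 50) else -6, Nat.card_pos, ?_, ?_⟩
  · intro g x hx
    dsimp only
    by_cases h1 : orderOf g ∈ lowOrders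
    · rw [if_pos h1]; exact certB_ge_one (lockedSupport_low h1 hx)
    · by_cases h2 : orderOf g ∈ fiveOrders
      · rw [if_neg h1, if_pos h2]; exact certB_locked_five (lockedSupport_five h2 hx)
      · rw [if_neg h1, if_neg h2]; exact certB_ge x
  · have hdisj : ∀ f : ℕ, f ∈ lowOrders → f ∉ fiveOrders := by decide
    have hdec : ∀ g : G, (if orderOf g ∈ lowOrders then (1 : ℝ) else if orderOf g ∈ fiveOrders then -(131 / 50) else -6) =
        -6 + 7 * (if orderOf g ∈ lowOrders then (1 : ℝ) else 0) + 169 / 50 * (if orderOf g ∈ fiveOrders then (1 : ℝ) else 0) := by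
      intro g
      by_cases h1 : orderOf g ∈ lowOrders
      · simp [h1, hdisj _ h1]; norm_num
      · by_cases h2 : orderOf g ∈ fiveOrders
        · simp [h1, h2]; norm_num
        · simp [h1, h2]
    rw [stPairing_certB, finsum_eq_sum_of_fintype, Finset.sum_congr rfl (fun g _ => hdec g)]
    simp only [Finset.sum_add_distrib, ← Finset.mul_sum, ← card_orderPred_eq_sum, Finset.sum_const, Finset.card_univ, nsmul_eq_mul]
    have hc : (400 : ℝ) * (Nat.card G : ℝ) <
        700 * (Nat.card {g : G // orderOf g ∈ lowOrders} : ℝ) + 338 * (Nat.card {g : G // orderOf g ∈ fiveOrders} : ℝ) := by exact_mod_cast h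
    rw [← Nat.card_eq_fintype_card]
    linarith

end Heart

end Summit.Langlands.Langlands.Theorems.DeterminantLockSplit
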